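import Literature.MathematicalPhysics.QuantumFieldTheory.Balaban1983to89.Node00.RepTowerOfRecord
import Literature.MathematicalPhysics.QuantumFieldTheory.Balaban1983to89.B14NodeKnitTowerDatum

/-!
# `Balaban1983to89.B14NodeKnitRecord9` — YM-DAG node N11 · [Balaban1988Convergent] CMP **119** (1988) 243–285, Theorem 1 p. 262
# (with the Theorem of p. 245 and the ASSUMED operation 𝐑 of p. 244): the N11 knit AT NODE 00's STAGE-₉ REPRESENTED TOWER OF RECORD — the slot
# families `slotsOfRecord` ∕ `slotsTOfRecord`, the densities `rhoOfRecord9` ∕ `trhoOfRecord9`, the T-step `tstepOfRecord` and the R-step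
# `rstepSlotOfRecord` (seats node00-def-T ∕ node00-def-R) —, instantiating `B14NodeKnitTowerDatum` §2 by `rfl`

statement-level bookkeeping over published theorems with citation tags; kernel-checked compositions of tree theorems;
nothing here is a claim about the Yang–Mills mass gap.

CITATION HEADER (lean-in-tree rule).  Source: T. Bałaban, *Convergent renormalization expansions for lattice gauge theories*,
Commun. Math. Phys. **119**, 243–285 (1988), doi:10.1007/bf01217741 [Balaban1988Convergent] (cell paper B14 = «[III]»): Thm 1 p. 262, the Theorem
of p. 245, (2.18) p. 257, the step (3.1) p. 264 ∕ (3.24)–(3.25) p. 270; 𝐑 = [Balaban1989LargeFieldI] (0.3) p. 176, ASSUMED in [III] p. 244.  Seat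
`pub-ymgap-dag-n11-a` (YM-PLAN Track A, HUMAN RULING D-0062: the KNIT-BY-NAME seat of node N11; chair R420 ∕ R422 ∕ R424 ∕ R434 ∕ R437 ∕ R439).
BY NAME and UNCHANGED: `…Node00.RepTowerOfRecord` (seat node00-def-T: `slotsOfRecord`, `slotsTOfRecord`, `rhoOfRecord9`, `slotsTOfRecord_succ`,
`slotsOfRecord_succ`, `slotsTOfRecord_zero`, `rhoOfRecord9_zero`), `…Node00.TStepOfRecord` (`tstepOfRecord`, `texpAOfRecord`, `StepWeightsOfRecord`,
`rhoZeroOfRecord` via `LargeFieldReprOfRecord`), `…Node00.RStepSlotOfRecord` (seat node00-def-R: `rstepSlotOfRecord`, `TexpASlot`, `PpSelOfRecord`,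
`TowerNumerics`), `…B14NodeKnitTowerDatum` (`b14_main_at_datumOfTower_slots`, `…_slots_along`, `densitiesDescribed_iff_laws_slots`),
`…T4DatumAssemblyTower` (`RGMachineCore`, `Tower`, `datumOfTower`), `…Dag` (`B14_main` :224), `…DagBinding` (`leavesP`, `WorldP`).

WHY THIS FILE (pub-ymgap chair R437 ∕ R439; NODE 00 Stage ₉).  Node00-def-T's `RepTowerOfRecord` fixes THE represented tower of record: post-𝐑 slots
`slotsOfRecord … p g k` (level 0 = `ρ₀` on every length-0 sequence; level k+1 = `rstepSlotOfRecord … (k+1)` of the T-step (†) `tstepOfRecord … k` of level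
k — `slotsOfRecord_succ`, `slotsTOfRecord_succ`, both `rfl`), pre-𝐑 slots `slotsTOfRecord … p g (k+1)` (the slots of `𝐓ρ_k`), and the densities of record
`rhoOfRecord9 … p g k = densityOfRepr … (slotsOfRecord …) p g k` (`ρ_k := eval rep_k`, explicit).  At a world bound to a tower datum `datumOfTower F N M τT`
whose tower's densities ARE these (`hρ`, `rfl` at NODE 00's `Record9`) and whose core reads its §2-form clause as «`ρ_k = rhoOfRecord9 … k` ∧ the laws
of the level-`k` slots» (`hS9`, `Iff.rfl` there), N11 at `(w, P)` follows from EXACTLY the three printed slots, now stated ON THE OBJECTS OF RECORD: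
(S0) the start slot `s ↦ ρ₀` obeys `Laws 0`; (S1ᵀ) THE THEOREM OF p. 245 — GIVEN the node's antecedents, for `k < K`, if the post-𝐑 slots of level k
obey `Laws k` then the pre-𝐑 slots of level k+1 (`slotsTOfRecord … (k+1)` = the T-step (†) of them) obey `LawsT k` ([III] §1 for k = 0, §3 + Thm 2 for
k ≥ 1); (𝐑) — GIVEN the `rOperation` leaf — the R-step of record carries `LawsT k` into `Laws (k+1)` ([III] p. 244; node N13), or, read ALONG the
tower, `LawsT k (slotsTOfRecord … (k+1)) → Laws (k+1) (slotsOfRecord … (k+1))` (what NODE 00's 𝐑-leaf pinned along the run's tower delivers).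
The laws `Laws`∕`LawsT` remain parameters (NODE 00 Stage ₉'s `Record9` ∕ the term tower of record pin them; seat dag-n11-a `N11-PIN-LIST.md` v5 §8).

WHAT THIS FILE PROVES (0 `sorry`, 0 `def`, standard axioms).  §0 (PROVISO-FREE) **`b14_main_at_construction_rhoOfRecord9[_along]`** (world bound to
`M.construction` over the densities of record along histories `gOf`; no tower obligation read), `densitiesDescribed_iff_laws_construction`,
`construction_eq_of_datumOfTower`; §1 **`b14_main_at_repTowerOfRecord`** (slots (S0), (S1ᵀ), (𝐑) with the R-step of record
named), **`b14_main_at_repTowerOfRecord_along`** ((𝐑) along the tower: N11 = (S0) + (S1ᵀ) at a world whose 𝐑-leaf is read along the tower),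
`densitiesDescribed_iff_laws_repTowerOfRecord` (N11's conclusion there IS `∀ k ≤ K, Laws k (slotsOfRecord … P g k)`), `laws_zero_iff_rhoZero` ((S0) is a
statement about the constant slot `s ↦ rhoZeroOfRecord F N P.K (g 0) (E P)`, `slotsTOfRecord_zero`), **`b14_main_at_repTowerOfRecord_lf`** (the same in the
tree's §2 currency `Repr ∧ Step.LFHyp ∧ LFHypImproved`, T-half with pre-𝐑 obligations `NewT` and 𝐑-half `Repr (k+1) ∧ LFNewTerms` separated).

HONEST FRAMING.  A count-neutral SLOT landing (R429 (4)(i)): N11 is NOT discharged; (S1ᵀ) = Sects. 1–3 + Thm 2 of [Balaban1988Convergent] at the slots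
of record is a displayed hypothesis; (𝐑) is the printed ASSUMPTION of p. 244 (discharged by [Balaban1989LargeFieldII], node N13); the machine core, the
tower datum, the step weights `w`, the selections `ppSel`, the constant `E`, the couplings `g` and the laws are parameters (NODE 00's `Record9` fixes
them; the step weights must be the printed ones for (S1ᵀ) to be provable — seat dag-n11-a probe `probe_JunkStepWeights`).  One finite four-torus
programme at fixed `ε`, Bałaban AS PRINTED with locators; nothing continuum ∕ ℝ⁴ ∕ OS ∕ mass gap ∕ Clay.
-/

noncomputable section

open MeasureTheory
open scoped BigOperators

namespace Literature.MathematicalPhysics.QuantumFieldTheory.Balaban1983to89.B14NodeKnitRecord9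

open DagBinding T4DatumAssembly T4Continuum Node00
open B14NodeKnitTowerDatum (b14_main_at_datumOfTower_slots b14_main_at_datumOfTower_slots_along densitiesDescribed_iff_laws_slots)

variable (F : T4Family) (N : ℕ) [NeZero N]
variable (M : RGMachineCore F (SU N)) (τT : M.Tower (avOfRecord F N)) (w : WorldP) (P : B12.RunParams)
variable (ν : Stage7Numerics) (τ : TowerNumerics) (E : B12.RunParams → ℝ) (wt : StepWeightsOfRecord F N ν τ.M)
  (ppSel : PpSelOfRecord F ν τ.M) (g : ℕ → ℝ)
variable (Laws : (k : ℕ) → TexpASlot F N ν τ.M P g k → Prop) (LawsT : (k : ℕ) → TexpASlot F N ν τ.M P g (k + 1) → Prop)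


/-! ## §0. Proviso-free form: a world bound to the core's construction OVER THE DENSITIES OF RECORD `rhoOfRecord9` along histories `gOf` -/

section Construction

variable (gOf : B12.RunParams → ℕ → ℝ)
variable (LawsP : (p : B12.RunParams) → (k : ℕ) → TexpASlot F N ν τ.M p (gOf p) k → Prop)
  (LawsTP : (p : B12.RunParams) → (k : ℕ) → TexpASlot F N ν τ.M p (gOf p) (k + 1) → Prop)

/-- **N11 AT THE CONSTRUCTION OVER THE DENSITIES OF RECORD, PROVISO-FREE** ([Balaban1988Convergent] Thm 1 p. 262 with the Theorem of p. 245 and the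
assumed 𝐑 of p. 244): `T4DatumAssembly.RGMachineCore.construction` assembles Bałaban's construction from the core `M` over ANY density tower — here THE
densities of record `p k ↦ rhoOfRecord9 … p (gOf p) k` along per-run coupling histories `gOf` (at NODE 00's record: `gOf p = genSeq M.βfun p.g0`, seat
dag-n23-a) —, with NO tower obligation (`isRT`, (0.4)) in sight: N11 reads none of them.  If the world is bound to that construction (`hC`; every tower datum
over these densities has this `C`, `datumOfTower_C`) and the core's §2-form clause at `(P, k)` IS the law of the level-`k` slots of record (`hS9` — the
«ρ_k = eval rep_k» conjunct of the Stage-₉ reading is `rfl` here and dropped), then `Dag.B14_main (leavesP w P)` follows from (S0), (S1ᵀ) on the slots of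
record and (𝐑) with the R-step of record. [cite: Balaban1988Convergent, Thm 1 p.262; Theorem p.245; (2.18) p.257; (3.24)–(3.25) p.270; p.244] -/
theorem b14_main_at_construction_rhoOfRecord9
    (hC : w.C = M.construction (fun p k => rhoOfRecord9 F N ν τ E wt ppSel p (gOf p) k))
    (hS9 : ∀ k, k ≤ P.K → (M.Sect2Form P k ↔ LawsP P k (slotsOfRecord F N ν τ E wt ppSel P (gOf P) k)))
    (h0 : (leavesP w P).smallCouplings → LawsP P 0 (slotsOfRecord F N ν τ E wt ppSel P (gOf P) 0))
    (hT : (leavesP w P).b7 → (leavesP w P).b8 → (leavesP w P).b9 → (leavesP w P).b10 → (leavesP w P).b11 →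
      (leavesP w P).smallCouplings → (leavesP w P).smallFieldInductive → (leavesP w P).flowControl →
        ∀ k, k < P.K → LawsP P k (slotsOfRecord F N ν τ E wt ppSel P (gOf P) k) →
          LawsTP P k (slotsTOfRecord F N ν τ E wt ppSel P (gOf P) (k + 1)))
    (hR : (leavesP w P).rOperation → ∀ k, k < P.K → ∀ f : TexpASlot F N ν τ.M P (gOf P) (k + 1),
      LawsTP P k f → LawsP P (k + 1) (rstepSlotOfRecord F N ν τ ppSel P (gOf P) (k + 1) f)) :
    Dag.B14_main (leavesP w P) :=
  B14NodeKnitRepTower.b14_main_of_repTower w P (Rep := fun k => TexpASlot F N ν τ.M P (gOf P) k)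
    (slotsOfRecord F N ν τ E wt ppSel P (gOf P)) (fun k => tstepOfRecord F N ν τ.M wt P (gOf P) k)
    (fun k => rstepSlotOfRecord F N ν τ ppSel P (gOf P) (k + 1)) (LawsP P) (LawsTP P)
    (fun k => slotsOfRecord_succ F N ν τ E wt ppSel P (gOf P) k)
    (fun k hk h => by
      rw [show (w.C P).Sect2Form k = M.Sect2Form P k by rw [hC]; rfl]
      exact (hS9 k hk).2 h)
    h0 hT hR

/-- The same with (𝐑) read ALONG the tower of record (`LawsT k (slotsTOfRecord … (k+1)) → Laws (k+1) (slotsOfRecord … (k+1))`): N11 = (S0) + (S1ᵀ) at a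
world whose 𝐑-leaf is read along the tower. [cite: Balaban1988Convergent, Thm 1 p.262; Theorem p.245; p.244] -/
theorem b14_main_at_construction_rhoOfRecord9_along
    (hC : w.C = M.construction (fun p k => rhoOfRecord9 F N ν τ E wt ppSel p (gOf p) k))
    (hS9 : ∀ k, k ≤ P.K → (M.Sect2Form P k ↔ LawsP P k (slotsOfRecord F N ν τ E wt ppSel P (gOf P) k)))
    (h0 : (leavesP w P).smallCouplings → LawsP P 0 (slotsOfRecord F N ν τ E wt ppSel P (gOf P) 0))
    (hT : (leavesP w P).b7 → (leavesP w P).b8 → (leavesP w P).b9 → (leavesP w P).b10 → (leavesP w P).b11 →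
      (leavesP w P).smallCouplings → (leavesP w P).smallFieldInductive → (leavesP w P).flowControl →
        ∀ k, k < P.K → LawsP P k (slotsOfRecord F N ν τ E wt ppSel P (gOf P) k) →
          LawsTP P k (slotsTOfRecord F N ν τ E wt ppSel P (gOf P) (k + 1)))
    (hR : (leavesP w P).rOperation → ∀ k, k < P.K →
      LawsTP P k (slotsTOfRecord F N ν τ E wt ppSel P (gOf P) (k + 1)) → LawsP P (k + 1) (slotsOfRecord F N ν τ E wt ppSel P (gOf P) (k + 1))) :
    Dag.B14_main (leavesP w P) :=
  B14NodeKnitRepTower.b14_main_of_repTower_along w P (Rep := fun k => TexpASlot F N ν τ.M P (gOf P) k)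
    (slotsOfRecord F N ν τ E wt ppSel P (gOf P)) (fun k => tstepOfRecord F N ν τ.M wt P (gOf P) k) (LawsP P) (LawsTP P)
    (fun k hk h => by
      rw [show (w.C P).Sect2Form k = M.Sect2Form P k by rw [hC]; rfl]
      exact (hS9 k hk).2 h)
    h0 hT hR

/-- … and there N11's CONCLUSION at `(w, P)` IS `∀ k ≤ K, Laws P k (slotsOfRecord … P (gOf P) k)`. [cite: Balaban1988Convergent, Thm 1 p.262 (bookkeeping)] -/
theorem densitiesDescribed_iff_laws_construction
    (hC : w.C = M.construction (fun p k => rhoOfRecord9 F N ν τ E wt ppSel p (gOf p) k))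
    (hS9 : ∀ k, k ≤ P.K → (M.Sect2Form P k ↔ LawsP P k (slotsOfRecord F N ν τ E wt ppSel P (gOf P) k))) :
    (leavesP w P).densitiesDescribed ↔ ∀ k, k ≤ P.K → LawsP P k (slotsOfRecord F N ν τ E wt ppSel P (gOf P) k) := by
  show (∀ k, k ≤ P.K → (w.C P).Sect2Form k) ↔ _
  refine forall₂_congr fun k hk => ?_
  rw [show (w.C P).Sect2Form k = M.Sect2Form P k by rw [hC]; rfl]
  exact hS9 k hk

/-- A tower datum over these densities IS such a world binding: `(datumOfTower F N M τT).C = M.construction τT.ρ` (`datumOfTower_C`) — so the tower-datum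
knits below are the special case `τT.ρ = fun p k => rhoOfRecord9 … p (gOf p) k`. [cite: Balaban1988Convergent, Thm 1 p.262 (bookkeeping)] -/
theorem construction_eq_of_datumOfTower (hC : w.C = (datumOfTower F N M τT).C)
    (hρ : ∀ p k, τT.ρ p k = rhoOfRecord9 F N ν τ E wt ppSel p (gOf p) k) :
    w.C = M.construction (fun p k => rhoOfRecord9 F N ν τ E wt ppSel p (gOf p) k) := by
  rw [hC, datumOfTower_C]
  congr 1
  funext p k
  exact hρ p k

end Construction

/-! ## §1. At a tower datum `datumOfTower F N M τT` whose densities are `rhoOfRecord9` -/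

/-- **N11 AT THE REPRESENTED TOWER OF RECORD** ([Balaban1988Convergent] Thm 1 p. 262 with the Theorem of p. 245 and the assumed 𝐑 of p. 244; NODE 00 Stage ₉,
seats node00-def-T ∕ node00-def-R): at a world bound to a tower datum (`hC`) whose densities are `rhoOfRecord9 … P g k` (`hρ`) and whose core reads its
§2-form clause as «of record ∧ laws of the level-`k` slots of record» (`hS9`), `Dag.B14_main (leavesP w P)` from: (S0) `h0` the start slot obeys `Laws 0`,
under the interval hypothesis; (S1ᵀ) `hT` THE THEOREM OF p. 245 ON THE SLOTS OF RECORD — GIVEN the in-edges `b7 … b11`, the interval hypothesis, the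
small-field inductive assumptions and the flow control (2.6): for `k < K`, `Laws k (slotsOfRecord … P g k) → LawsT k (slotsTOfRecord … P g (k+1))` (the pre-𝐑
slots of `𝐓ρ_k` = the T-step (†) of the post-𝐑 slots, `slotsTOfRecord_succ`); (𝐑) `hR` — GIVEN the `rOperation` leaf — the R-step of record
`rstepSlotOfRecord … P g (k+1)` carries `LawsT k` into `Laws (k+1)`.  `B14NodeKnitTowerDatum.b14_main_at_datumOfTower_slots` with `hsucc := slotsOfRecord_succ`
(`rfl`). [cite: Balaban1988Convergent, Thm 1 p.262; Theorem p.245; (2.18) p.257; (3.24)–(3.25) p.270; p.244] -/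
theorem b14_main_at_repTowerOfRecord (hC : w.C = (datumOfTower F N M τT).C)
    (hρ : ∀ k, τT.ρ P k = rhoOfRecord9 F N ν τ E wt ppSel P g k)
    (hS9 : ∀ k, k ≤ P.K →
      (M.Sect2Form P k ↔ (τT.ρ P k = rhoOfRecord9 F N ν τ E wt ppSel P g k ∧ Laws k (slotsOfRecord F N ν τ E wt ppSel P g k))))
    (h0 : (leavesP w P).smallCouplings → Laws 0 (slotsOfRecord F N ν τ E wt ppSel P g 0))
    (hT : (leavesP w P).b7 → (leavesP w P).b8 → (leavesP w P).b9 → (leavesP w P).b10 → (leavesP w P).b11 →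
      (leavesP w P).smallCouplings → (leavesP w P).smallFieldInductive → (leavesP w P).flowControl →
        ∀ k, k < P.K → Laws k (slotsOfRecord F N ν τ E wt ppSel P g k) → LawsT k (slotsTOfRecord F N ν τ E wt ppSel P g (k + 1)))
    (hR : (leavesP w P).rOperation → ∀ k, k < P.K → ∀ f : TexpASlot F N ν τ.M P g (k + 1),
      LawsT k f → Laws (k + 1) (rstepSlotOfRecord F N ν τ ppSel P g (k + 1) f)) :
    Dag.B14_main (leavesP w P) :=
  b14_main_at_datumOfTower_slots F N M τT w P ν τ.M g (slotsOfRecord F N ν τ E wt ppSel)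
    (fun k => tstepOfRecord F N ν τ.M wt P g k) (fun k => rstepSlotOfRecord F N ν τ ppSel P g (k + 1)) Laws LawsT hC
    (fun k => slotsOfRecord_succ F N ν τ E wt ppSel P g k) hρ hS9 h0 hT hR

/-- **N11 AT THE REPRESENTED TOWER OF RECORD, (𝐑) READ ALONG THE TOWER** (`LawsT k (slotsTOfRecord … (k+1)) → Laws (k+1) (slotsOfRecord … (k+1))` — the form
NODE 00's 𝐑-leaf pinned along the run's tower delivers): N11 at `(w, P)` = (S0) + (S1ᵀ) there.
[cite: Balaban1988Convergent, Thm 1 p.262; Theorem p.245; p.244] -/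
theorem b14_main_at_repTowerOfRecord_along (hC : w.C = (datumOfTower F N M τT).C)
    (hρ : ∀ k, τT.ρ P k = rhoOfRecord9 F N ν τ E wt ppSel P g k)
    (hS9 : ∀ k, k ≤ P.K →
      (M.Sect2Form P k ↔ (τT.ρ P k = rhoOfRecord9 F N ν τ E wt ppSel P g k ∧ Laws k (slotsOfRecord F N ν τ E wt ppSel P g k))))
    (h0 : (leavesP w P).smallCouplings → Laws 0 (slotsOfRecord F N ν τ E wt ppSel P g 0))
    (hT : (leavesP w P).b7 → (leavesP w P).b8 → (leavesP w P).b9 → (leavesP w P).b10 → (leavesP w P).b11 →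
      (leavesP w P).smallCouplings → (leavesP w P).smallFieldInductive → (leavesP w P).flowControl →
        ∀ k, k < P.K → Laws k (slotsOfRecord F N ν τ E wt ppSel P g k) → LawsT k (slotsTOfRecord F N ν τ E wt ppSel P g (k + 1)))
    (hR : (leavesP w P).rOperation → ∀ k, k < P.K →
      LawsT k (slotsTOfRecord F N ν τ E wt ppSel P g (k + 1)) → Laws (k + 1) (slotsOfRecord F N ν τ E wt ppSel P g (k + 1))) :
    Dag.B14_main (leavesP w P) :=
  b14_main_at_datumOfTower_slots_along F N M τT w P ν τ.M g (slotsOfRecord F N ν τ E wt ppSel)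
    (fun k => tstepOfRecord F N ν τ.M wt P g k) Laws LawsT hC hρ hS9 h0 hT hR

/-- Under that reading N11's CONCLUSION at `(w, P)` IS «every post-𝐑 slot family of record obeys the laws», `∀ k ≤ K, Laws k (slotsOfRecord … P g k)`.
[cite: Balaban1988Convergent, Thm 1 p.262 (bookkeeping)] -/
theorem densitiesDescribed_iff_laws_repTowerOfRecord (hC : w.C = (datumOfTower F N M τT).C)
    (hρ : ∀ k, τT.ρ P k = rhoOfRecord9 F N ν τ E wt ppSel P g k)
    (hS9 : ∀ k, k ≤ P.K →
      (M.Sect2Form P k ↔ (τT.ρ P k = rhoOfRecord9 F N ν τ E wt ppSel P g k ∧ Laws k (slotsOfRecord F N ν τ E wt ppSel P g k)))) :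
    (leavesP w P).densitiesDescribed ↔ ∀ k, k ≤ P.K → Laws k (slotsOfRecord F N ν τ E wt ppSel P g k) :=
  densitiesDescribed_iff_laws_slots F N M τT w P ν τ.M g (slotsOfRecord F N ν τ E wt ppSel) Laws hC hρ hS9

/-- **(S0) is a statement about the constant slot `s ↦ ρ₀`**: the level-0 post-𝐑 slot family of record IS `fun _ => rhoZeroOfRecord F N P.K (g 0) (E P)`
(node00-def-T's `texpAOfRecord_zero` ∕ `slotsTOfRecord_zero`, `rfl`) — so (S0) reads `Laws 0 (fun _ => ρ₀)`: the one-term representation of the Wilson start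
(Thm 1 p. 262: *«Let us consider the sequence of densities ρ_k starting with ρ₀ = exp[−(1/g₀²)A(U) − E]»*; `χ_0 ≡ 1`).
[cite: Balaban1988Convergent, Thm 1 p.262, (2.18) p.257 (bookkeeping)] -/
theorem laws_zero_iff_rhoZero :
    Laws 0 (slotsOfRecord F N ν τ E wt ppSel P g 0) ↔ Laws 0 (fun _ => rhoZeroOfRecord F N P.K (g 0) (E P)) :=
  Iff.rfl


section LF

open Step
open B14NodeKnitTowerDatum (b14_main_at_datumOfTower_lf)

variable {G' : Type*} [GaugeGroup G'] {Φ 𝒢 𝔄 : Type*} {Pₛ : Params} (T : LFTower Pₛ G' Φ 𝒢 𝔄) (c : LFConsts) (βc : ℝ)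

/-- **N11 AT THE REPRESENTED TOWER OF RECORD IN THE TREE'S §2 CURRENCY** ([Balaban1988Convergent] Thm 1 p. 262: «form, conditions AND BOUNDS»): the core's
clause read as `ρ_k = rhoOfRecord9 … k ∧ (Repr k ∧ Step.LFHyp T c k ∧ Step.LFHypImproved T c βc k)` over a term tower `T` with representation predicates
`Repr k` («the level-`k` slots of record are represented by `T`'s terms up to `k`») ∕ `ReprT k` (pre-𝐑) and pre-𝐑 new-term obligations `NewT k` (p. 279);
slots: signs under the interval hypothesis, (S0) `Repr 0`, (S1ᵀ) the Theorem of p. 245 (T-half), (𝐑) p. 244 delivering `Repr (k+1) ∧ LFNewTerms T c βc k`.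
`B14NodeKnitTowerDatum.b14_main_at_datumOfTower_lf` at `rep := slotsOfRecord … P g`, `eval := densityOfSlice`. [cite: Balaban1988Convergent, Thm 1 p.262; Theorem p.245; p.279; pp.258–262; p.244] -/
theorem b14_main_at_repTowerOfRecord_lf (hC : w.C = (datumOfTower F N M τT).C) (Repr ReprT NewT : ℕ → Prop)
    (hρ : ∀ k, τT.ρ P k = rhoOfRecord9 F N ν τ E wt ppSel P g k)
    (hS9 : ∀ k, k ≤ P.K →
      (M.Sect2Form P k ↔ (τT.ρ P k = rhoOfRecord9 F N ν τ E wt ppSel P g k ∧ (Repr k ∧ LFHyp T c k ∧ LFHypImproved T c βc k))))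
    (hsg : (leavesP w P).smallCouplings → LFSigns T c βc P.K)
    (h0 : (leavesP w P).smallCouplings → Repr 0)
    (hT : (leavesP w P).b7 → (leavesP w P).b8 → (leavesP w P).b9 → (leavesP w P).b10 → (leavesP w P).b11 →
      (leavesP w P).smallCouplings → (leavesP w P).smallFieldInductive → (leavesP w P).flowControl →
        ∀ k, k < P.K → Repr k → LFHyp T c k → LFHypImproved T c βc k → ReprT k ∧ NewT k)
    (hR : (leavesP w P).rOperation → ∀ k, k < P.K → ReprT k → NewT k → Repr (k + 1) ∧ LFNewTerms T c βc k) :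
    Dag.B14_main (leavesP w P) :=
  b14_main_at_datumOfTower_lf F N M τT w P (Rep := fun k => TexpASlot F N ν τ.M P g k) (slotsOfRecord F N ν τ E wt ppSel P g)
    (fun k f => densityOfSlice F N ν τ.M P g k f) T c βc hC Repr ReprT NewT hρ hS9 hsg h0 hT hR

end LF

/-! ## §2. RECORD-SHAPE form: N11 at every run of every world of ANY record predicate certifying «D = a tower datum over the densities of
record of some admissible parameter θ under provisos h» (the shape of NODE 00's `IsRecordOfRecord₉C`, def-T RECORD9-DESIGN-g2 §6) -/

section RecordShape

variable {F N}
variable {Θ : Type*} (Prov Adm : Θ → Prop) (νOf : Θ → Stage7Numerics) (τOf : Θ → TowerNumerics)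
  (EOf : Θ → B12.RunParams → ℝ) (wOf : (θ : Θ) → StepWeightsOfRecord F N (νOf θ) (τOf θ).M)
  (ppOf : (θ : Θ) → PpSelOfRecord F (νOf θ) (τOf θ).M) (gOf : Θ → B12.RunParams → ℕ → ℝ)
  (core : Θ → RGMachineCore F (SU N)) (datum : (θ : Θ) → Prov θ → FiniteEpsData F (SU N))
  (Rec : FiniteEpsData F (SU N) → WorldP → Prop)

/-- **N11 AT EVERY WORLD OF A STAGE-9-SHAPED RECORD PREDICATE** ([Balaban1988Convergent] Thm 1 p. 262 with the Theorem of p. 245 and the assumed 𝐑 of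
p. 244).  Data: a parameter type `Θ` (NODE 00's `Stage9Params`), displayed provisos `Prov` and admissibility `Adm`, per-parameter numerics ∕ constant ∕
step weights ∕ selections ∕ coupling histories (`νOf`, `τOf`, `EOf`, `wOf`, `ppOf`, `gOf` — def-T's `θ.ν`, `θ.τ9`, `EOfRecord₉ θ`, `wOfRecord₉ θ`, `θ.ppSel`,
`gOfRecord₉ θ`), a machine core `core θ` (`coreOfRecord₉ θ`) and a datum `datum θ h` (`datumOfRecord₉ θ h`) whose construction IS the core's over the
densities of record (`hdatum` — `rfl` there: `datumOfTower_C` + `towerOfRecord9_ρ`), and a record predicate `Rec` every instance of which names such a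
`(θ, h)` with `Adm θ`, `D = datum θ h`, `w.C = D.C` (`hRec` — the first conjuncts of `IsRecordOfRecord₉C`).  IF for every admissible `(θ, h)` there are
law families `LawsP`, `LawsTP` on the slots of record with, at every world so bound and every run, the reading of the core's §2-form clause (`hS9`;
the Stage-5 pin (P3) while `S218` is residual, `Iff` by `repr218Holds_iff` once def-T's §9 `S218OfRecord₉` pins it) and the slots (S0), (S1ᵀ) (THE
THEOREM OF p. 245 on the slots of record, GIVEN the node's antecedents), (𝐑) (the R-law for the R-step of record, GIVEN the leaf), THEN N11 holds at every
run of every `Rec`-world.  §0 `b14_main_at_construction_rhoOfRecord9` under the record's existential.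
[cite: Balaban1988Convergent, Thm 1 p.262; Theorem p.245; (2.18) p.257; (3.24)–(3.25) p.270; p.244] -/
theorem b14_main_forall_of_recordShape
    (hdatum : ∀ (θ : Θ) (h : Prov θ), (datum θ h).C =
      (core θ).construction (fun p k => rhoOfRecord9 F N (νOf θ) (τOf θ) (EOf θ) (wOf θ) (ppOf θ) p (gOf θ p) k))
    (hRec : ∀ (D : FiniteEpsData F (SU N)) (w : WorldP), Rec D w → ∃ (θ : Θ) (h : Prov θ), Adm θ ∧ D = datum θ h ∧ w.C = D.C)
    (slots : ∀ (θ : Θ) (h : Prov θ), Adm θ →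
      ∃ (LawsP : (p : B12.RunParams) → (k : ℕ) → TexpASlot F N (νOf θ) (τOf θ).M p (gOf θ p) k → Prop)
        (LawsTP : (p : B12.RunParams) → (k : ℕ) → TexpASlot F N (νOf θ) (τOf θ).M p (gOf θ p) (k + 1) → Prop),
        ∀ (w : WorldP) (P : B12.RunParams), w.C = (datum θ h).C →
          (∀ k, k ≤ P.K → ((core θ).Sect2Form P k ↔
            LawsP P k (slotsOfRecord F N (νOf θ) (τOf θ) (EOf θ) (wOf θ) (ppOf θ) P (gOf θ P) k))) ∧
          ((leavesP w P).smallCouplings →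
            LawsP P 0 (slotsOfRecord F N (νOf θ) (τOf θ) (EOf θ) (wOf θ) (ppOf θ) P (gOf θ P) 0)) ∧
          ((leavesP w P).b7 → (leavesP w P).b8 → (leavesP w P).b9 → (leavesP w P).b10 → (leavesP w P).b11 →
            (leavesP w P).smallCouplings → (leavesP w P).smallFieldInductive → (leavesP w P).flowControl →
              ∀ k, k < P.K →
                LawsP P k (slotsOfRecord F N (νOf θ) (τOf θ) (EOf θ) (wOf θ) (ppOf θ) P (gOf θ P) k) →
                LawsTP P k (slotsTOfRecord F N (νOf θ) (τOf θ) (EOf θ) (wOf θ) (ppOf θ) P (gOf θ P) (k + 1))) ∧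
          ((leavesP w P).rOperation → ∀ k, k < P.K → ∀ f : TexpASlot F N (νOf θ) (τOf θ).M P (gOf θ P) (k + 1),
            LawsTP P k f → LawsP P (k + 1) (rstepSlotOfRecord F N (νOf θ) (τOf θ) (ppOf θ) P (gOf θ P) (k + 1) f))) :
    ∀ (D : FiniteEpsData F (SU N)) (w : WorldP), Rec D w → ∀ P : B12.RunParams, Dag.B14_main (leavesP w P) := by
  intro D w hw P
  obtain ⟨θ, h, hadm, hD, hC⟩ := hRec D w hw
  obtain ⟨LawsP, LawsTP, hslots⟩ := slots θ h hadm
  obtain ⟨hS9, h0, hT, hR⟩ := hslots w P (by rw [hC, hD])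
  exact b14_main_at_construction_rhoOfRecord9 F N (core θ) w P (νOf θ) (τOf θ) (EOf θ) (wOf θ) (ppOf θ) (gOf θ) LawsP LawsTP
    (by rw [hC, hD, hdatum]) hS9 h0 hT hR

/-- The same with (𝐑) read ALONG the tower of record: N11 = (S0) + (S1ᵀ) at every world of such a record whose 𝐑-leaf is read along the tower.
[cite: Balaban1988Convergent, Thm 1 p.262; Theorem p.245; p.244] -/
theorem b14_main_forall_of_recordShape_along
    (hdatum : ∀ (θ : Θ) (h : Prov θ), (datum θ h).C =
      (core θ).construction (fun p k => rhoOfRecord9 F N (νOf θ) (τOf θ) (EOf θ) (wOf θ) (ppOf θ) p (gOf θ p) k))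
    (hRec : ∀ (D : FiniteEpsData F (SU N)) (w : WorldP), Rec D w → ∃ (θ : Θ) (h : Prov θ), Adm θ ∧ D = datum θ h ∧ w.C = D.C)
    (slots : ∀ (θ : Θ) (h : Prov θ), Adm θ →
      ∃ (LawsP : (p : B12.RunParams) → (k : ℕ) → TexpASlot F N (νOf θ) (τOf θ).M p (gOf θ p) k → Prop)
        (LawsTP : (p : B12.RunParams) → (k : ℕ) → TexpASlot F N (νOf θ) (τOf θ).M p (gOf θ p) (k + 1) → Prop),
        ∀ (w : WorldP) (P : B12.RunParams), w.C = (datum θ h).C →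
          (∀ k, k ≤ P.K → ((core θ).Sect2Form P k ↔
            LawsP P k (slotsOfRecord F N (νOf θ) (τOf θ) (EOf θ) (wOf θ) (ppOf θ) P (gOf θ P) k))) ∧
          ((leavesP w P).smallCouplings →
            LawsP P 0 (slotsOfRecord F N (νOf θ) (τOf θ) (EOf θ) (wOf θ) (ppOf θ) P (gOf θ P) 0)) ∧
          ((leavesP w P).b7 → (leavesP w P).b8 → (leavesP w P).b9 → (leavesP w P).b10 → (leavesP w P).b11 →
            (leavesP w P).smallCouplings → (leavesP w P).smallFieldInductive → (leavesP w P).flowControl →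
              ∀ k, k < P.K →
                LawsP P k (slotsOfRecord F N (νOf θ) (τOf θ) (EOf θ) (wOf θ) (ppOf θ) P (gOf θ P) k) →
                LawsTP P k (slotsTOfRecord F N (νOf θ) (τOf θ) (EOf θ) (wOf θ) (ppOf θ) P (gOf θ P) (k + 1))) ∧
          ((leavesP w P).rOperation → ∀ k, k < P.K →
            LawsTP P k (slotsTOfRecord F N (νOf θ) (τOf θ) (EOf θ) (wOf θ) (ppOf θ) P (gOf θ P) (k + 1)) →
            LawsP P (k + 1) (slotsOfRecord F N (νOf θ) (τOf θ) (EOf θ) (wOf θ) (ppOf θ) P (gOf θ P) (k + 1)))) :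
    ∀ (D : FiniteEpsData F (SU N)) (w : WorldP), Rec D w → ∀ P : B12.RunParams, Dag.B14_main (leavesP w P) := by
  intro D w hw P
  obtain ⟨θ, h, hadm, hD, hC⟩ := hRec D w hw
  obtain ⟨LawsP, LawsTP, hslots⟩ := slots θ h hadm
  obtain ⟨hS9, h0, hT, hR⟩ := hslots w P (by rw [hC, hD])
  exact b14_main_at_construction_rhoOfRecord9_along F N (core θ) w P (νOf θ) (τOf θ) (EOf θ) (wOf θ) (ppOf θ) (gOf θ) LawsP LawsTP
    (by rw [hC, hD, hdatum]) hS9 h0 hT hR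

end RecordShape

end Literature.MathematicalPhysics.QuantumFieldTheory.Balaban1983to89.B14NodeKnitRecord9

end
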